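/-
Copyright (c) 2026 the pub-hodgecm-mathlib formalisation cell (harness21).  Prover seat hodgecm-mathlib-LH7-p04 (g13), 2026-09-03.  Line LH4 ∕ L2-3 «CM glue» of the dyadic
(D-UNR) road (census `CENSUS-L23-CM.v1.LH10p01g12.md` ROW 2, fence `φ_θ` everywhere, LEAD T15-55): the 2-FREE twin «BINDERS-θ TYPE (1)» of ★ `TypeOneCayleyShiftBindersCM`, FILE B of two
(§3 the type-(1) shifted binders, §4 «non-Levi is preserved»; file A `TypeFreeHermitianShiftDenominatorsCM` = §§1–2) — the σ-fixed pair `(c+1, c−1 ∣ c−1, c+1)` (which needs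
`|2|_w = 1`) is replaced by the HERMITIAN pair `(θ, c−θ ∣ c−σθ, σθ)`, `θ + σθ = 1`, `|θ|_w ≤ 1` (any residue characteristic).
-/
import Literature.NumberTheory.Rogawski1990.TypeFreeHermitianShiftDenominatorsCM  -- file A (this seat): §1 scalars, §2 `isUnit_hermitianShift_denominators_of_disc_lt`; brings ★ γ₃, ★ P3, ★ P2
import Literature.NumberTheory.Rogawski1990.TypeOneCayleyShiftBindersCM          -- ★ (pattern; `trace_det_disc_of_isRoot_of_isRoot`, `smul_diagonal_add_smul_one_fin_two`); brings ★ `MatrixMoebiusShiftInverse` (`det_smul_conj_add_smul_one`)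
import Literature.NumberTheory.Automorphic.MatrixMoebiusShiftHermitian          -- ★ P1 (LH10-p01 (g12)): `valued_hermitianMoebius_scalar_sub_one_le_of_level` (ED. 2), `moebius_conj'`
import Literature.NumberTheory.Automorphic.MatrixGenMoebiusShift               -- ★ (LH4-p01 (g12)) four-scalar kit: `map_genMoebius`, `genMoebius_neg_genMoebius`, `isUnit_det_neg_smul_genMoebius_add_smul_one`
import HarnessLib

/-!
# The hermitian Cayley shift at a CM place, TYPE (1) — no `|2| = 1` (file B): the shifted roots `α ↦ φ_θ(α)` at depth `N − 1`, `G`-regularity of the shift, and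
# «non-Levi is preserved»

Topic `NumberTheory/Rogawski1990`; namespace `Literature.NumberTheory.Rogawski1990`.  THEOREMS ONLY
(no definition, no instance, no notation, no named fact, no `sorry`); kernel lane `--supports stmt-HodgeConjecture-24833`.  Cell `pub/hodgecm-mathlib`, crux H413; line LH4, organ
`stub_DyUnramCore` ∕ L2-3, CM-glue road (carriers ★ `TypeTwoHermitianShiftCM`, (A3)-θ ★ `FinExplicitTransferFactorHermitianShiftSum`, LH4-p01 (g12); type (2) binders
`TypeTwoHermitianShiftBindersCM`, this seat).  Files A+B are the θ-twin of ★ `TypeOneCayleyShiftBindersCM` (F0P2-p02 (g11)) token for token, with `h2 : |2|_w = 1` REPLACED by the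
road's hermitian binders `(θ : LocalRing L v) (hθ : θ + conjLocal θ = 1) (hθv : |θ_w| ≤ 1)`, `h4c : IsUnit ((c+1)² − (c−1)²)` by `hΔ : IsUnit (θσθ − (c−θ)(c−σθ))`, and the pair
`(c+1, c−1 ∣ c−1, c+1) ↦ (θ, c−θ ∣ c−σθ, σθ)`.  HONEST LABEL: HC_CM is proved only modulo the cell's 2 remaining named inputs (hLiu418, h413) until rung 0 closes; this file is an
ASSEMBLY over ★ material and asserts nothing printed.

THE MATHEMATICS.  `w ∣ v` non-split, `c ∈ E_v` with `σ(c) = c`, `|c_w| = exp(−1)`; `θ ∈ E_v`, `θ + σθ = 1`, `|θ_w| ≤ 1`; `φ_θ(M) = (θM + (c−θ))((c−σθ)M + σθ)⁻¹`, on scalars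
`φ_θ(x) = (θx + (c−θ)) ∕ ((c−σθ)x + σθ)` (file A: `|φ_θ x − φ_θ y| = q·|x − y|` on `2`-deep points, unit denominators under `|disc χ_{g_w}|_w < exp(−2)`).  §3 TYPE (1): if `χ_{g_w}` has the two roots `α ≠ γ`, `|α − γ| = exp(−N)`,
`N ≥ 2`, `|α − 1|, |γ − 1| ≤ exp(−2)`, and `γ_H′ = (φ_θ g, φ_θ u)` on matrices, then `χ_{g′_w}` has the roots `φ_θ α ≠ φ_θ γ` at depth `N − 1`, both `≡ 1`, `|χ_{g′}(u′)|_w =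
exp(−(n−2))` (★ P3), and `γ_H′` is `G`-regular.  §4 «NON-LEVI IS PRESERVED»: if `γ_H′.1` is `H_v`-conjugate to a diagonal then so is `γ_H.1 = ψ(γ_H′.1)` (`ψ = φ_{σθ, −(c−θ) ∣
−(c−σθ), θ}`, ★ `genMoebius_neg_genMoebius`, ★ P1 `moebius_conj'`).

## References
* [Rogawski1990] J. D. Rogawski, *Automorphic Representations of Unitary Groups in Three Variables*, Ann. of Math. Stud. 123 (1990), §4.9 Prop. 4.9.1 (a)(b) p. 55; §4.3 p. 42.
* [Kottwitz1986BaseChangeUnits] R. E. Kottwitz, *Base change for unit elements of Hecke algebras*, Compositio Math. 60 (1986), §2 pp. 244–247.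
* [Flicker1998UnitaryFL] Y. Z. Flicker, *Elementary proof of the fundamental lemma for a unitary group*, Canad. J. Math. 50 (1998), §6.
* [SerreLocalFields1979] J.-P. Serre, *Local Fields*, GTM 67 (1979), Ch. I §§1–2 (discrete valuations).
-/

set_option autoImplicit false

noncomputable section

open NumberField IsDedekindDomain Matrix Polynomial
open scoped MatrixGroups WithZero

namespace Literature.NumberTheory.Rogawski1990

open Literature.NumberTheory.Automorphic Literature.NumberTheory.Automorphic.UnitaryGroup Literature.NumberTheory.Automorphic.MoebiusShift
open Literature.NumberTheory.GaloisRepresentations Literature.NumberTheory.NumberFields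

variable (L : Type) [Field L] [NumberField L] [IsCMField L] (v : HeightOneSpectrum (𝓞 ↥(maximalRealSubfield L)))
  (w : PlacesOver L v) (hw : IsCMField.complexConj L • w.1 = w.1)

/-! ## §3 Type (1): the hermitian-shifted roots at depth `N − 1`, the value `|χ_{g′}(u′)|_w`, and `G`-regularity of the shift -/

include hw in
set_option maxHeartbeats 800000 in
-- the carriers' types are large (same budget as ★ `shifted_binders_of_typeOne`)
/-- **THE HERMITIAN-SHIFTED BINDERS, TYPE (1)**: for a deep `γ_H = (g, u)` (`g_w ≡ 1`, `u_w ≡ 1 (mod c_w)` entrywise) whose `χ_{g_w}` has the two roots `α ≠ γ` with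
`|α − γ| = exp(−N)`, `N ≥ 2`, `|α − 1|, |γ − 1| ≤ exp(−2)`, with `|χ_g(u)|_w = exp(−n)`, `n ≥ 2`, `θ + σθ = 1`, `|θ_w| ≤ 1`, and any `γ_H′` on the carriers with `g′ = φ_θ(g)`,
`u′ = φ_θ(u)` as matrices: `χ_{g′_w}` has the roots `α′ = φ_θ(α)`, `γ′ = φ_θ(γ)` (`φ_θ(x) = (θ_w x + (c_w − θ_w)) ∕ ((c_w − (σθ)_w) x + (σθ)_w)`), `α′ ≠ γ′`, `|α′ − γ′| = exp(−(N−1))`,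
`|α′ − 1| < 1`, `|γ′ − 1| < 1`, `|χ_{g′}(u′)|_w = exp(−(n−2))`, and `γ_H′` is `G`-regular — the binders of the θ-twins of ★ END `stableOrbitalIntegralRel_chi_shift_of_isRoot` and of
★ (A3)-θ at `u_H = γ_H′` (★ P2 `eval_charpoly_genMoebius_fin_two`, `disc_genMoebius_fin_two`; ★ P3 `valued_eval_charpoly_hermitianMoebius_of_exp`; ★ P1
`valued_hermitianMoebius_scalar_sub_one_le_of_level`; ★ γ₃ `separable_of_map_evalRingHom`; θ-twin of ★ `shifted_binders_of_typeOne`, NO `|2|_w = 1`).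
[cite: Rogawski1990, §4.9 Prop. 4.9.1 (a)(b) p. 55; §4.3 p. 42] [cite: Kottwitz1986BaseChangeUnits, §2 pp. 244–247] [cite: Flicker1998UnitaryFL, §6] -/
theorem hermitianShifted_binders_of_typeOne
    (γH γH' : (cmDatum L 2 (Matrix.of fun i j : Fin 2 => if i.val + j.val + 1 = 2 then (1 : L) else 0)).Local v ×
      (cmDatum L 1 (Matrix.of fun i j : Fin 1 => if i.val + j.val + 1 = 1 then (1 : L) else 0)).Local v)
    {c : LocalRing L v} (hσc : conjLocal L (IsCMField.complexConj L) v c = c) (hc : Valued.v (c w) = WithZero.exp (-1 : ℤ))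
    (θ : LocalRing L v) (hθ : θ + conjLocal L (IsCMField.complexConj L) v θ = 1) (hθv : Valued.v (θ w) ≤ 1)
    (h1 : ((γH'.1.val : GL (Fin 2) (LocalRing L v)).val : Matrix (Fin 2) (Fin 2) (LocalRing L v)) =
      (θ • ((γH.1.val : GL (Fin 2) (LocalRing L v)).val : Matrix (Fin 2) (Fin 2) (LocalRing L v)) + (c - θ) • 1) *
        ((c - conjLocal L (IsCMField.complexConj L) v θ) • ((γH.1.val : GL (Fin 2) (LocalRing L v)).val : Matrix (Fin 2) (Fin 2) (LocalRing L v)) +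
          conjLocal L (IsCMField.complexConj L) v θ • 1)⁻¹)
    (hu' : finGammaTwo L v γH' = (θ * finGammaTwo L v γH + (c - θ)) *
      Ring.inverse ((c - conjLocal L (IsCMField.complexConj L) v θ) * finGammaTwo L v γH + conjLocal L (IsCMField.complexConj L) v θ))
    (hg1 : ∀ i j, Valued.v ((((γH.1.val : GL (Fin 2) (LocalRing L v)).val.map (Pi.evalRingHom (fun w' : PlacesOver L v => w'.1.adicCompletion L) w)) - 1) i j) ≤ Valued.v (c w))
    (hu1 : Valued.v (finGammaTwo L v γH w - 1) ≤ Valued.v (c w))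
    (α γ : w.1.adicCompletion L)
    (hα : ((((γH.1.val : GL (Fin 2) (LocalRing L v)) : Matrix (Fin 2) (Fin 2) (LocalRing L v)).charpoly).map (Pi.evalRingHom (fun w' : PlacesOver L v => w'.1.adicCompletion L) w)).IsRoot α)
    (hγ : ((((γH.1.val : GL (Fin 2) (LocalRing L v)) : Matrix (Fin 2) (Fin 2) (LocalRing L v)).charpoly).map (Pi.evalRingHom (fun w' : PlacesOver L v => w'.1.adicCompletion L) w)).IsRoot γ)
    (hαγ : α ≠ γ) (N : ℕ) (hN : Valued.v (α - γ) = WithZero.exp (-(N : ℤ))) (h2N : 2 ≤ N)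
    (hα2 : Valued.v (α - 1) ≤ WithZero.exp (-2 : ℤ)) (hγ2 : Valued.v (γ - 1) ≤ WithZero.exp (-2 : ℤ))
    {n : ℕ} (hn2 : 2 ≤ n)
    (hn : Valued.v (((finCharpolyTwo L v γH).eval (finGammaTwo L v γH)) w) = WithZero.exp (-(n : ℤ))) :
    ((((γH'.1.val : GL (Fin 2) (LocalRing L v)) : Matrix (Fin 2) (Fin 2) (LocalRing L v)).charpoly).map (Pi.evalRingHom (fun w' : PlacesOver L v => w'.1.adicCompletion L) w)).IsRoot
        ((θ w * α + (c w - θ w)) / ((c w - conjLocal L (IsCMField.complexConj L) v θ w) * α + conjLocal L (IsCMField.complexConj L) v θ w)) ∧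
    ((((γH'.1.val : GL (Fin 2) (LocalRing L v)) : Matrix (Fin 2) (Fin 2) (LocalRing L v)).charpoly).map (Pi.evalRingHom (fun w' : PlacesOver L v => w'.1.adicCompletion L) w)).IsRoot
        ((θ w * γ + (c w - θ w)) / ((c w - conjLocal L (IsCMField.complexConj L) v θ w) * γ + conjLocal L (IsCMField.complexConj L) v θ w)) ∧
    (θ w * α + (c w - θ w)) / ((c w - conjLocal L (IsCMField.complexConj L) v θ w) * α + conjLocal L (IsCMField.complexConj L) v θ w) ≠
      (θ w * γ + (c w - θ w)) / ((c w - conjLocal L (IsCMField.complexConj L) v θ w) * γ + conjLocal L (IsCMField.complexConj L) v θ w) ∧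
    Valued.v ((θ w * α + (c w - θ w)) / ((c w - conjLocal L (IsCMField.complexConj L) v θ w) * α + conjLocal L (IsCMField.complexConj L) v θ w) -
        (θ w * γ + (c w - θ w)) / ((c w - conjLocal L (IsCMField.complexConj L) v θ w) * γ + conjLocal L (IsCMField.complexConj L) v θ w)) =
      WithZero.exp (-((N - 1 : ℕ) : ℤ)) ∧
    Valued.v ((θ w * α + (c w - θ w)) / ((c w - conjLocal L (IsCMField.complexConj L) v θ w) * α + conjLocal L (IsCMField.complexConj L) v θ w) - 1) < 1 ∧
    Valued.v ((θ w * γ + (c w - θ w)) / ((c w - conjLocal L (IsCMField.complexConj L) v θ w) * γ + conjLocal L (IsCMField.complexConj L) v θ w) - 1) < 1 ∧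
    Valued.v (((finCharpolyTwo L v γH').eval (finGammaTwo L v γH')) w) = WithZero.exp (-((n - 2 : ℕ) : ℤ)) ∧
    IsLocalGRegular L v γH' := by
  have hv : Subsingleton (PlacesOver L v) := PlacesOver.subsingleton_of_smul_eq (IsCMField.complexConj L) (IsCMField.complexConj_ne_one L) w hw
  -- the hermitian parameter at `w`: `(σθ)_w = σ_w θ_w`, `θ_w + σ_w θ_w = 1`
  set evw : LocalRing L v →+* w.1.adicCompletion L := Pi.evalRingHom (fun w' : PlacesOver L v => w'.1.adicCompletion L) w with hevw
  set σw := galAdicCompletionMap (L := L) (IsCMField.complexConj L) hw with hσw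
  set gw : Matrix (Fin 2) (Fin 2) (w.1.adicCompletion L) := ((γH.1.val : GL (Fin 2) (LocalRing L v)).val.map evw) with hgw
  set uw : w.1.adicCompletion L := finGammaTwo L v γH w with huw
  set cw : w.1.adicCompletion L := c w with hcw
  obtain ⟨hc0, hc1, -, -, -, -⟩ := shift_parameter_facts hc
  have hSθ : conjLocal L (IsCMField.complexConj L) v θ w = σw (θ w) :=
    conjLocal_apply_eq_of_smul_eq (IsCMField.complexConj L) (IsCMField.complexConj_ne_one L) v w hw θ
  have hSθ' : evw (conjLocal L (IsCMField.complexConj L) v θ) = σw (θ w) := hSθ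
  have hθw : θ w + σw (θ w) = 1 := by
    have h := congrFun hθ w
    rw [Pi.add_apply, Pi.one_apply] at h
    rw [← hSθ']; exact h
  have e2 : Valued.v cw ^ 2 = WithZero.exp (-2 : ℤ) := by rw [hc, ← WithZero.exp_nsmul]; norm_num
  -- the characteristic polynomial at `w` and its discriminant `(α − γ)²`
  have hchar : (((γH.1.val : GL (Fin 2) (LocalRing L v)) : Matrix (Fin 2) (Fin 2) (LocalRing L v)).charpoly).map evw = gw.charpoly := by
    rw [hgw, Matrix.charpoly_map]
  rw [hchar] at hα hγ
  obtain ⟨-, -, hdiscg⟩ := trace_det_disc_of_isRoot_of_isRoot gw hα hγ hαγ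
  have hdiscv : Valued.v (gw.trace ^ 2 - 4 * gw.det) = WithZero.exp (-((2 * N : ℕ) : ℤ)) := by
    rw [hdiscg, map_pow, hN, ← WithZero.exp_nsmul]
    congr 1
    simp only [smul_neg, nsmul_eq_mul, Nat.cast_ofNat, Nat.cast_mul]
  have hdisc : Valued.v (gw.trace ^ 2 - 4 * gw.det) < WithZero.exp (-2 : ℤ) := by
    rw [hdiscv, WithZero.exp_lt_exp]; omega
  obtain ⟨hw2m, -, hw1m, -, hU2m, -, hU1m, -, -, -, -⟩ := isUnit_hermitianShift_denominators_of_disc_lt L v w hw γH hσc hc θ hθ hθv hg1 hu1 hdisc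
  -- `g′_w = φ_θ(g_w)` and `u′_w = φ_θ(u_w)`
  have hg'w : ((γH'.1.val : GL (Fin 2) (LocalRing L v)).val.map evw) =
      (θ w • gw + (cw - θ w) • (1 : Matrix (Fin 2) (Fin 2) (w.1.adicCompletion L))) *
        ((cw - σw (θ w)) • gw + σw (θ w) • (1 : Matrix (Fin 2) (Fin 2) (w.1.adicCompletion L)))⁻¹ := by
    rw [h1, map_genMoebius evw _ _ _ _ _ hU2m, map_sub, map_sub, hSθ']
    rfl
  have hD2w : Valued.v (((cw - σw (θ w)) • gw + σw (θ w) • (1 : Matrix (Fin 2) (Fin 2) (w.1.adicCompletion L))).det) = WithZero.exp (-2 : ℤ) := by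
    have e1 : (((c - conjLocal L (IsCMField.complexConj L) v θ) • ((γH.1.val : GL (Fin 2) (LocalRing L v)).val : Matrix (Fin 2) (Fin 2) (LocalRing L v)) +
        conjLocal L (IsCMField.complexConj L) v θ • (1 : Matrix (Fin 2) (Fin 2) (LocalRing L v))).det) w =
        evw (((c - conjLocal L (IsCMField.complexConj L) v θ) • ((γH.1.val : GL (Fin 2) (LocalRing L v)).val : Matrix (Fin 2) (Fin 2) (LocalRing L v)) +
        conjLocal L (IsCMField.complexConj L) v θ • (1 : Matrix (Fin 2) (Fin 2) (LocalRing L v))).det) := rfl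
    have e : (((c - conjLocal L (IsCMField.complexConj L) v θ) • ((γH.1.val : GL (Fin 2) (LocalRing L v)).val : Matrix (Fin 2) (Fin 2) (LocalRing L v)) +
        conjLocal L (IsCMField.complexConj L) v θ • (1 : Matrix (Fin 2) (Fin 2) (LocalRing L v))).det) w =
        (((cw - σw (θ w)) • gw + σw (θ w) • (1 : Matrix (Fin 2) (Fin 2) (w.1.adicCompletion L))).det) := by
      rw [e1, RingHom.map_det, RingHom.mapMatrix_apply, map_smul_add_smul_one, map_sub, hSθ']
      rfl
    rw [← e]; exact hw2m
  have hD0 : ((cw - σw (θ w)) • gw + σw (θ w) • (1 : Matrix (Fin 2) (Fin 2) (w.1.adicCompletion L))).det ≠ 0 := fun h => by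
    rw [h, map_zero] at hD2w; exact WithZero.zero_ne_coe hD2w
  have hscw : ((c - conjLocal L (IsCMField.complexConj L) v θ) * finGammaTwo L v γH + conjLocal L (IsCMField.complexConj L) v θ) w = (cw - σw (θ w)) * uw + σw (θ w) := by
    show evw ((c - conjLocal L (IsCMField.complexConj L) v θ) * finGammaTwo L v γH + conjLocal L (IsCMField.complexConj L) v θ) = _
    rw [map_add, map_mul, map_sub, hSθ']
    rfl
  have hw1m' : Valued.v ((cw - σw (θ w)) * uw + σw (θ w)) = WithZero.exp (-1 : ℤ) := by rw [← hscw]; exact hw1m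
  have huw' : finGammaTwo L v γH' w = (θ w * uw + (cw - θ w)) / ((cw - σw (θ w)) * uw + σw (θ w)) := by
    have hmul : finGammaTwo L v γH' * ((c - conjLocal L (IsCMField.complexConj L) v θ) * finGammaTwo L v γH + conjLocal L (IsCMField.complexConj L) v θ) =
        θ * finGammaTwo L v γH + (c - θ) := by
      rw [hu', mul_assoc, Ring.inverse_mul_cancel _ hU1m, mul_one]
    have hmw := congrFun hmul w
    rw [Pi.mul_apply, hscw] at hmw
    have hne : (cw - σw (θ w)) * uw + σw (θ w) ≠ 0 := fun h => by
      rw [h, map_zero] at hw1m'; exact WithZero.zero_ne_coe hw1m'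
    rw [eq_div_iff hne, hmw]
    rfl
  -- (1)(2) the shifted roots
  obtain ⟨hDα, -⟩ := valued_hermitianShift_scalar_denominators_of_deep σw hθw hθv hc hα2
  obtain ⟨hDγ, -⟩ := valued_hermitianShift_scalar_denominators_of_deep σw hθw hθv hc hγ2
  have hDα0 : (cw - σw (θ w)) * α + σw (θ w) ≠ 0 := fun h => by rw [h, map_zero] at hDα; exact WithZero.zero_ne_coe hDα
  have hDγ0 : (cw - σw (θ w)) * γ + σw (θ w) ≠ 0 := fun h => by rw [h, map_zero] at hDγ; exact WithZero.zero_ne_coe hDγ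
  have hchar' : (((γH'.1.val : GL (Fin 2) (LocalRing L v)) : Matrix (Fin 2) (Fin 2) (LocalRing L v)).charpoly).map evw =
      ((θ w • gw + (cw - θ w) • (1 : Matrix (Fin 2) (Fin 2) (w.1.adicCompletion L))) *
        ((cw - σw (θ w)) • gw + σw (θ w) • (1 : Matrix (Fin 2) (Fin 2) (w.1.adicCompletion L)))⁻¹).charpoly := by
    rw [← Matrix.charpoly_map, ← hg'w]
  have hrootα := isRoot_charpoly_genMoebius_of_isRoot gw (θ w) (cw - θ w) (σw (θ w)) (cw - σw (θ w)) α hD0 hDα0 hα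
  have hrootγ := isRoot_charpoly_genMoebius_of_isRoot gw (θ w) (cw - θ w) (σw (θ w)) (cw - σw (θ w)) γ hD0 hDγ0 hγ
  -- (4) the depth `N − 1`
  have hN' : Valued.v ((θ w * α + (cw - θ w)) / ((cw - σw (θ w)) * α + σw (θ w)) - (θ w * γ + (cw - θ w)) / ((cw - σw (θ w)) * γ + σw (θ w))) =
      WithZero.exp (-((N - 1 : ℕ) : ℤ)) := by
    rw [valued_hermitianMoebius_scalar_sub σw hθw hθv hc hα2 hγ2, hN, ← WithZero.exp_add]
    congr 1
    omega
  -- (3) distinct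
  have hne' : (θ w * α + (cw - θ w)) / ((cw - σw (θ w)) * α + σw (θ w)) ≠ (θ w * γ + (cw - θ w)) / ((cw - σw (θ w)) * γ + σw (θ w)) := fun h => by
    rw [← sub_eq_zero] at h
    rw [h, map_zero] at hN'
    exact WithZero.zero_ne_coe hN'
  -- (5)(6) `α′, γ′ ≡ 1` (★ P1 scalar level lemma at `j = 1`)
  have hlvl : ∀ {x : w.1.adicCompletion L}, Valued.v (x - 1) ≤ WithZero.exp (-2 : ℤ) →
      Valued.v ((θ w * x + (cw - θ w)) / ((cw - σw (θ w)) * x + σw (θ w)) - 1) < 1 := fun {x} hx => by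
    have h := (valued_hermitianMoebius_scalar_sub_one_le_of_level σw hθw hθv hc x le_rfl (by rw [e2]; exact hx)).1
    rw [pow_one] at h
    exact lt_of_le_of_lt h hc1
  -- (7) the value `χ_{g′}(u′)`
  have hev : ∀ (γ : (cmDatum L 2 (Matrix.of fun i j : Fin 2 => if i.val + j.val + 1 = 2 then (1 : L) else 0)).Local v ×
      (cmDatum L 1 (Matrix.of fun i j : Fin 1 => if i.val + j.val + 1 = 1 then (1 : L) else 0)).Local v),
      ((finCharpolyTwo L v γ).eval (finGammaTwo L v γ)) w = (((γ.1.val : GL (Fin 2) (LocalRing L v)).val.map evw).charpoly).eval (finGammaTwo L v γ w) := fun γ => by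
    have e : ((finCharpolyTwo L v γ).eval (finGammaTwo L v γ)) w = evw ((finCharpolyTwo L v γ).eval (finGammaTwo L v γ)) := rfl
    rw [e, ← Polynomial.eval₂_at_apply, ← Polynomial.eval_map, finCharpolyTwo, ← Matrix.charpoly_map]
    rfl
  have hnw : Valued.v (gw.charpoly.eval uw) = WithZero.exp (-(n : ℤ)) := by rw [hgw, huw, ← hev]; exact hn
  have hn' := valued_eval_charpoly_hermitianMoebius_of_exp σw hθw hc gw uw hD2w hw1m' hn2 hnw
  rw [← hg'w, ← huw'] at hn'
  rw [← hev] at hn'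
  -- (8) `G`-regularity: separability at `w`, lifted to `E_v`
  have hc1' : (1 : w.1.adicCompletion L) - cw ≠ 0 := fun h => by
    rw [sub_eq_zero] at h
    rw [← h, map_one] at hc1
    exact lt_irrefl _ hc1
  have hΔ0 : θ w * σw (θ w) - (cw - θ w) * (cw - σw (θ w)) ≠ 0 := by
    rw [hermitianPair_key_scalar σw hθw cw]
    exact mul_ne_zero hc0 hc1'
  have hdiscg0 : gw.trace ^ 2 - 4 * gw.det ≠ 0 := fun h => by
    rw [h, map_zero] at hdiscv; exact WithZero.zero_ne_coe hdiscv
  have hdisc' : ((γH'.1.val : GL (Fin 2) (LocalRing L v)).val.map evw).trace ^ 2 - 4 * ((γH'.1.val : GL (Fin 2) (LocalRing L v)).val.map evw).det ≠ 0 := fun h => by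
    have key := disc_genMoebius_fin_two gw (θ w) (cw - θ w) (σw (θ w)) (cw - σw (θ w)) hD0
    rw [← hg'w, h, zero_mul] at key
    exact (mul_ne_zero (pow_ne_zero 2 hΔ0) hdiscg0) key.symm
  have hval' : (((γH'.1.val : GL (Fin 2) (LocalRing L v)).val.map evw).charpoly).eval (finGammaTwo L v γH' w) ≠ 0 := fun h => by
    rw [hev, h, map_zero] at hn'; exact WithZero.zero_ne_coe hn'
  have hsepw := separable_charpoly_mul_X_sub_C _ _ hdisc' hval'
  have hreg' : IsLocalGRegular L v γH' := by
    have hgoal : (((γH'.1.val : GL (Fin 2) (LocalRing L v)).val : Matrix (Fin 2) (Fin 2) (LocalRing L v)).charpoly *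
        ((γH'.2.val : GL (Fin 1) (LocalRing L v)).val : Matrix (Fin 1) (Fin 1) (LocalRing L v)).charpoly).Separable := by
      refine separable_of_map_evalRingHom L v w hv _ ?_
      rw [Polynomial.map_mul, ← Matrix.charpoly_map, ← Matrix.charpoly_map]
      have hUc : (((γH'.2.val : GL (Fin 1) (LocalRing L v)).val : Matrix (Fin 1) (Fin 1) (LocalRing L v)).map evw).charpoly = X - C (finGammaTwo L v γH' w) := by
        rw [Matrix.charpoly, Matrix.det_fin_one, Matrix.charmatrix_apply_eq, Matrix.map_apply]
        rfl
      rw [hUc]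
      exact hsepw
    simp only [IsLocalGRegular, IsGRegular, IsRegularElt, coe_endoEmb, coe_endoGL, Matrix.charpoly_reindex, Matrix.charpoly_fromBlocks_zero₁₂]
    exact hgoal
  refine ⟨?_, ?_, ?_, ?_, ?_, ?_, hn', hreg'⟩
  · rw [hchar', hSθ]; exact hrootα
  · rw [hchar', hSθ]; exact hrootγ
  · rw [hSθ]; exact hne'
  · rw [hSθ]; exact hN'
  · rw [hSθ]; exact hlvl hα2
  · rw [hSθ]; exact hlvl hγ2

/-! ## §4 «Non-Levi is preserved by the hermitian shift» -/

/-- **NON-LEVI IS PRESERVED BY THE HERMITIAN CAYLEY SHIFT**: if `γ_H′ = (φ_θ g, ·)` on matrices (`θσθ − (c−θ)(c−σθ)` and `det((c−σθ)g + σθ)` units) and `γ_H.1` is NOT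
`H_v`-conjugate to a diagonal torus element, then neither is `γ_H′.1` — for `y γ_H′.1 y⁻¹ = diag(d′)` gives `y γ_H.1 y⁻¹ = ψ(diag d′)` (`ψ = φ_{σθ, −(c−θ) ∣ −(c−σθ), θ}` undoes
`φ_θ`, ★ `genMoebius_neg_genMoebius`, and commutes with conjugation, ★ P1 `moebius_conj'`), a diagonal matrix with unit entries (θ-twin of ★ `not_levi_of_shift`, `h4c ↦ hΔ`).
[cite: Rogawski1990, §4.9 Prop. 4.9.1 (a) p. 55] [cite: Kottwitz1986BaseChangeUnits, §2 pp. 244–247] -/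
theorem not_levi_of_hermitianShift
    (γH γH' : (cmDatum L 2 (Matrix.of fun i j : Fin 2 => if i.val + j.val + 1 = 2 then (1 : L) else 0)).Local v ×
      (cmDatum L 1 (Matrix.of fun i j : Fin 1 => if i.val + j.val + 1 = 1 then (1 : L) else 0)).Local v)
    {c : LocalRing L v} (θ : LocalRing L v)
    (hΔ : IsUnit (θ * conjLocal L (IsCMField.complexConj L) v θ - (c - θ) * (c - conjLocal L (IsCMField.complexConj L) v θ)))
    (h1 : ((γH'.1.val : GL (Fin 2) (LocalRing L v)).val : Matrix (Fin 2) (Fin 2) (LocalRing L v)) =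
      (θ • ((γH.1.val : GL (Fin 2) (LocalRing L v)).val : Matrix (Fin 2) (Fin 2) (LocalRing L v)) + (c - θ) • 1) *
        ((c - conjLocal L (IsCMField.complexConj L) v θ) • ((γH.1.val : GL (Fin 2) (LocalRing L v)).val : Matrix (Fin 2) (Fin 2) (LocalRing L v)) +
          conjLocal L (IsCMField.complexConj L) v θ • 1)⁻¹)
    (hD1 : IsUnit ((c - conjLocal L (IsCMField.complexConj L) v θ) • ((γH.1.val : GL (Fin 2) (LocalRing L v)).val : Matrix (Fin 2) (Fin 2) (LocalRing L v)) +
      conjLocal L (IsCMField.complexConj L) v θ • (1 : Matrix (Fin 2) (Fin 2) (LocalRing L v))).det)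
    (hell : ¬ ∃ (y : ((cmDatum L 2 (Matrix.of fun i j : Fin 2 => if i.val + j.val + 1 = 2 then (1 : L) else 0)).Local v ×
        (cmDatum L 1 (Matrix.of fun i j : Fin 1 => if i.val + j.val + 1 = 1 then (1 : L) else 0)).Local v)) (d' : Fin 2 → (UnitaryGroup.LocalRing L v)ˣ),
        glDiagonal 2 (UnitaryGroup.LocalRing L v) d' = ((y * γH * y⁻¹).1.val : GL (Fin 2) (UnitaryGroup.LocalRing L v))) :
    ¬ ∃ (y : ((cmDatum L 2 (Matrix.of fun i j : Fin 2 => if i.val + j.val + 1 = 2 then (1 : L) else 0)).Local v ×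
        (cmDatum L 1 (Matrix.of fun i j : Fin 1 => if i.val + j.val + 1 = 1 then (1 : L) else 0)).Local v)) (d' : Fin 2 → (UnitaryGroup.LocalRing L v)ˣ),
        glDiagonal 2 (UnitaryGroup.LocalRing L v) d' = ((y * γH' * y⁻¹).1.val : GL (Fin 2) (UnitaryGroup.LocalRing L v)) := by
  rintro ⟨y, d', hd⟩
  apply hell
  -- abbreviations (`S = σθ`, `a = θ`, `b = c − θ`, `a′ = S`, `b′ = c − S`)
  set S : LocalRing L v := conjLocal L (IsCMField.complexConj L) v θ with hS
  set G : Matrix (Fin 2) (Fin 2) (LocalRing L v) := ((γH.1.val : GL (Fin 2) (LocalRing L v)).val : Matrix (Fin 2) (Fin 2) (LocalRing L v)) with hG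
  set Y : Matrix (Fin 2) (Fin 2) (LocalRing L v) := ((y.1.val : GL (Fin 2) (LocalRing L v)).val : Matrix (Fin 2) (Fin 2) (LocalRing L v)) with hY
  have hYdet : IsUnit Y.det := Matrix.isUnits_det_units _
  have hGdet : IsUnit G.det := Matrix.isUnits_det_units _
  have hψD : IsUnit (((-(c - S)) • ((θ • G + (c - θ) • 1) * ((c - S) • G + S • 1)⁻¹) + θ • (1 : Matrix (Fin 2) (Fin 2) (LocalRing L v))).det) :=
    isUnit_det_neg_smul_genMoebius_add_smul_one G hΔ hD1
  -- the matrices of the two conjugates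
  have hcoe' : (y * γH' * y⁻¹).1.val = y.1.val * γH'.1.val * y.1.val⁻¹ := rfl
  have hcoe : (y * γH * y⁻¹).1.val = y.1.val * γH.1.val * y.1.val⁻¹ := rfl
  have hd' : Matrix.diagonal (fun k => (d' k : LocalRing L v)) = Y * ((θ • G + (c - θ) • 1) * ((c - S) • G + S • 1)⁻¹) * Y⁻¹ := by
    have h := congrArg (fun g : GL (Fin 2) (LocalRing L v) => g.val) hd
    rw [coe_glDiagonal, hcoe', Units.val_mul, Units.val_mul, Matrix.coe_units_inv, h1] at h
    exact h
  -- `Y G Y⁻¹ = ψ(diag d′)`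
  have key : Y * G * Y⁻¹ =
      (S • Matrix.diagonal (fun k => (d' k : LocalRing L v)) + (-(c - θ)) • (1 : Matrix (Fin 2) (Fin 2) (LocalRing L v))) *
        ((-(c - S)) • Matrix.diagonal (fun k => (d' k : LocalRing L v)) + θ • (1 : Matrix (Fin 2) (Fin 2) (LocalRing L v)))⁻¹ := by
    rw [hd', moebius_conj' _ _ hYdet _ _ _ _ hψD, genMoebius_neg_genMoebius G hΔ hD1]
  -- the `ψ`-denominator at `diag d′` is diagonal with unit entries
  have hDd : IsUnit (((-(c - S)) • Matrix.diagonal (fun k => (d' k : LocalRing L v)) + θ • (1 : Matrix (Fin 2) (Fin 2) (LocalRing L v))).det) := by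
    rw [hd', det_smul_conj_add_smul_one _ _ hYdet]; exact hψD
  rw [smul_diagonal_add_smul_one_fin_two, smul_diagonal_add_smul_one_fin_two] at key
  rw [smul_diagonal_add_smul_one_fin_two, Matrix.det_diagonal, Fin.prod_univ_two] at hDd
  have hDu : ∀ k : Fin 2, IsUnit (-(c - S) * (d' k : LocalRing L v) + θ) :=
    Fin.forall_fin_two.2 ⟨isUnit_of_mul_isUnit_left hDd, isUnit_of_mul_isUnit_right hDd⟩
  have hinv : (Matrix.diagonal (fun k => -(c - S) * (d' k : LocalRing L v) + θ))⁻¹ =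
      Matrix.diagonal (fun k => (((hDu k).unit⁻¹ : (LocalRing L v)ˣ) : LocalRing L v)) := by
    refine Matrix.inv_eq_left_inv ?_
    rw [Matrix.diagonal_mul_diagonal, ← Matrix.diagonal_one]
    congr 1
    funext k
    exact (hDu k).val_inv_mul
  rw [hinv, Matrix.diagonal_mul_diagonal] at key
  -- the entries of the diagonal `Y G Y⁻¹` are units
  have hedet : IsUnit (Matrix.diagonal (fun k => (S * (d' k : LocalRing L v) + -(c - θ)) * (((hDu k).unit⁻¹ : (LocalRing L v)ˣ) : LocalRing L v))).det := by
    rw [← key, Matrix.det_conj ((Matrix.isUnit_iff_isUnit_det Y).2 hYdet)]; exact hGdet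
  rw [Matrix.det_diagonal, Fin.prod_univ_two] at hedet
  have heu : ∀ k : Fin 2, IsUnit ((S * (d' k : LocalRing L v) + -(c - θ)) * (((hDu k).unit⁻¹ : (LocalRing L v)ˣ) : LocalRing L v)) :=
    Fin.forall_fin_two.2 ⟨isUnit_of_mul_isUnit_left hedet, isUnit_of_mul_isUnit_right hedet⟩
  refine ⟨y, fun k => (heu k).unit, Units.ext ?_⟩
  rw [coe_glDiagonal, hcoe, Units.val_mul, Units.val_mul, Matrix.coe_units_inv]
  change Matrix.diagonal (fun k => (((heu k).unit : (LocalRing L v)ˣ) : LocalRing L v)) = Y * G * Y⁻¹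
  rw [key]
  congr 1

end Literature.NumberTheory.Rogawski1990

end
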